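import Summits.QuantumFields.YangMills.Theorems.AlphaInputsT3ACv3StepTrivPins
import HarnessLib

/-!
# `AlphaInputsT3ACv3StepTrivPinsChartAxial` — THE AXIAL INSTANCE OF THE WEIGHTED-FIBRE-CHART HYPOTHESIS `hchart` of `…AlphaInputsT3ACv3StepTrivPinsChart`
# (`G = SU(2)`, the lane's axial averaging at level `k`): `(T_kρ)(V) = e^{(log σ₀ + 3 log g_k)·N}·∫ J(V,A′)·ρ(U(V,A′)) dA′` with `N = #Free`, the chart
# `U(V,A′) = FluctGaussSU2.fieldAt U₁ g_k V A′` and the weight `J = 𝟙{‖g_kA′‖ < π}·Π_b σ(g_kA′_b)∕σ₀` — so the averaging-agnostic rows of that file SPECIALISE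
# to the axial rows of `…StepTrivPins` ∕ `…StepLowTrivPins`, and the same lemma is the TEMPLATE for the `blockAvg ℰp` instance (B2-F2∕F3)
# (cell ym3-torus; desk pub/ym-inputs INPUT-LIST v7 §3 I-10 ∕ I-12, memo `I10-B2-FIBRE-LOCATE-p08.md`; seat ym-inputs-p08 g2; `--supports stmt-QuantumFields-20520`)

WHAT IS PROVED.  `hchart_axial`: for the lane's AC tower with `(X.av k).avg = axialAvg` (standing range), a background section `U₁` axial on the forest
with `Ū₁(V) = V`, and every measurable BOUNDED gauge-invariant density `ρ` on the level-`k` fields,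
`rnTransport (X.av k).avg ρ =ᵐ V ↦ exp((log σ₀ + 3·log g_k)·#Free)·∫ A′, (𝟙_{ball}(g_kA′)·Π_b σ(g_kA′_b)∕σ₀)·ρ(fieldAt U₁ g_k V A′) dA′` — the lane's
(10)+(13)+(18)+scaling chain for a GENERAL integrand (`AxialGaugeShift.rnTransport_ae_eq_integral_fluct`, `FluctChartSU2.integral_fluct_su2_eq_integral_chart`,
`ChartScalingSU2.integral_pi_expMeasure` ∕ `integral_comp_smul_E3`, `FluctGaussSU2.prod_expWeight_eq`), i.e. exactly the hypothesis `hchart` of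
`PinnedStepTrivPins.fibre55WinAC_triv_of_chart` ∕ `fibre57LowOnAC_of_chart` with `Ω = (Free → E3)`, `vol` = Lebesgue, `ℓσ = log σ₀`, `d_g = 3`, `N = #Free`;
and `fieldAt_mem_fibre`: the chart lands in the fibres (`hfibΦ`).  [folklore] bookkeeping over the lane's kernel theorems; nothing of [Balaban1985UV3]
asserted; count-neutral; no summit ∕ sub-problem statement proved (rung R3 bookkeeping; not Clay).  Def-free; L-floor: none.
References: T. Bałaban, CMP 102 (1985) 255–275 [Balaban1985UV3] ((10) p.258, (13)–(18) pp.259–260, (22) p.261, (48)–(51) p.268).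
-/

set_option autoImplicit false

noncomputable section

namespace Summit.QuantumFields.YangMills.Theorems.PinnedStepTrivPins

open MeasureTheory Metric Literature.MathematicalPhysics.QuantumFieldTheory.Balaban1983to89
open Literature.MathematicalPhysics.QuantumFieldTheory.Balaban1983to89.AveragingRT (axialAvg rnTransport)
open Literature.MathematicalPhysics.QuantumFieldTheory.Balaban1983to89.GaugeField (GaugeInvariant)
open Literature.MathematicalPhysics.QuantumFieldTheory.Balaban1983to89.T4HaarSU2ExpChart (expWeight expPoint expMeasure)
open Literature.MathematicalPhysics.QuantumFieldTheory.Balaban1985CMP102 Literature.MathematicalPhysics.QuantumFieldTheory.Balaban1985CMP102.Setting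
open Summit.QuantumFields.Balaban3D.Carriers
open Summit.QuantumFields.Balaban3D.Proofs.Inputs (LaneConsts)
open Summit.QuantumFields.Balaban3D.Proofs.ScalesArithmetic (gk_pos)
open Summit.QuantumFields.Balaban3D.Proofs.StandardAC
open Summit.QuantumFields.Balaban3D.Proofs.ProductChartSU2 (SU2)
open Summit.QuantumFields.Balaban3D.Proofs.AxialGauge (measurable_crossParam)
open Summit.QuantumFields.Balaban3D.Proofs.AxialGaugeFix (forest axGlue)
open Summit.QuantumFields.Balaban3D.Proofs.AxialGaugeShift (fluct rnTransport_ae_eq_integral_fluct)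
open Summit.QuantumFields.Balaban3D.Proofs.FibreSplit (splitEquiv)
open Summit.QuantumFields.Balaban3D.Proofs.FluctChartSU2 (IsDummy fluctFree integral_fluct_su2_eq_integral_chart)
open Summit.QuantumFields.Balaban3D.Proofs.FluctGaussSU2
open Summit.QuantumFields.Balaban3D.Proofs.ChartScalingSU2 (E3 integral_pi_expMeasure integral_comp_smul_E3)

variable {L : ℕ} {S : Scales L} (X : ExternalInputsAC S SU2)

/-- The chart `fieldAt U₁ g V A′ = U′(gA′)·U₁(V)` lands in the fibre of `V` (the `hfibΦ` of the chart rows). [cite: Balaban1985UV3, (12)–(13) p.258–259] -/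
theorem fieldAt_mem_fibre (k : ℕ) [DecidableEq (PBond S.P k)] (hk : k + 1 ≤ S.P.m + S.P.K)
    (U₁ : GaugeField S.P (k + 1) SU2 → GaugeField S.P k SU2) (hax : ∀ V, ∀ b ∈ forest S.P k, U₁ V b = 1)
    (hfib : ∀ V, axialAvg (U₁ V) = V) (g : ℝ) (V : GaugeField S.P (k + 1) SU2) (A : Free S.P k → E3) :
    axialAvg (fieldAt U₁ g V A) = V := by
  unfold fieldAt fluctFree
  exact axialAvg_fluct_mul k hk U₁ hax hfib V _

/-- ★ **THE AXIAL INSTANCE OF `hchart`** (module docstring). [cite: Balaban1985UV3, (10) p.258 + (13)–(18) pp.259–260 + (22) p.261] -/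
theorem hchart_axial (k : ℕ) [DecidableEq (PBond S.P k)] (hk : k + 1 ≤ S.P.m + S.P.K) (hav : (X.av k).avg = axialAvg)
    (U₁ : GaugeField S.P (k + 1) SU2 → GaugeField S.P k SU2) (hax : ∀ V, ∀ b ∈ forest S.P k, U₁ V b = 1)
    (hfib : ∀ V, axialAvg (U₁ V) = V) (ρ : Density S.P k SU2) (C : ℝ) (hρm : Measurable ρ) (hρb : ∀ U, |ρ U| ≤ C)
    (hρinv : GaugeInvariant ρ) :
    rnTransport (X.av k).avg ρ =ᵐ[fieldMeasure S.P (k + 1) SU2] fun V =>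
      Real.exp ((Real.log sigma0 + 3 * Real.log (S.gk k)) * (Fintype.card (Free S.P k) : ℝ)) *
        ∫ A, (Set.univ.pi fun _ : Free S.P k => ball (0 : E3) Real.pi).indicator (fun _ => (1 : ℝ)) (S.gk k • A) *
          (∏ i, expWeight ((S.gk k • A) i) / sigma0) * ρ (fieldAt U₁ (S.gk k) V A) ∂(volume : Measure (Free S.P k → E3)) := by
  have hρi : Integrable ρ (fieldMeasure S.P k SU2) := AveragingRT.integrable_of_abs_le hρm _ hρb
  have hg : 0 < S.gk k := gk_pos S k
  rw [hav]
  refine (rnTransport_ae_eq_integral_fluct hk ρ hρi hρm hρinv U₁ hax hfib).trans (Filter.Eventually.of_forall fun V => ?_)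
  -- the fibre integrand as a function of the fluctuation field
  set F : GaugeField S.P k SU2 → ℝ := fun U' => ρ (fun b => U' b * U₁ V b) with hF
  have hmul : Measurable fun U' : GaugeField S.P k SU2 => (fun b => U' b * U₁ V b : GaugeField S.P k SU2) :=
    measurable_pi_iff.mpr fun b => (measurable_pi_apply b).mul measurable_const
  have hFm : Measurable F := hρm.comp hmul
  have hFb : ∀ U', |F U'| ≤ C := fun U' => hρb _
  have hfluct : Measurable fun W : GaugeField S.P k SU2 => (fluct W : GaugeField S.P k SU2) := by
    refine measurable_pi_iff.mpr fun b => ?_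
    unfold fluct axGlue
    exact (measurable_pi_apply b).comp ((measurable_crossParam hk).comp
      (measurable_const.prodMk (T4TreeGaugeFixing.measurable_fixTo _ _)))
  have hsymm : Measurable fun w : Free S.P k → SU2 => (splitEquiv (IsDummy (P := S.P) (j := k))).symm (w, fun _ => (1 : SU2)) :=
    (splitEquiv (IsDummy (P := S.P) (j := k))).symm.measurable.comp (measurable_id.prodMk measurable_const)
  have h1 := integral_fluct_su2_eq_integral_chart hk F
    (AveragingRT.integrable_of_abs_le (hFm.comp hfluct) C fun W => hFb _)
    (Measurable.aestronglyMeasurable (hFm.comp (hfluct.comp hsymm)))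
  show ∫ W, F (fluct W) ∂(fieldMeasure S.P k SU2) = _
  rw [h1, integral_pi_expMeasure, ← integral_indicator (MeasurableSet.univ_pi fun _ => measurableSet_ball),
    integral_comp_smul_E3 _ hg, smul_eq_mul]
  -- pointwise: the indicator-weighted chart integrand is `σ₀^N·(J·ρ∘fieldAt)`
  have hpt : ∀ A : Free S.P k → E3,
      (Set.univ.pi fun _ : Free S.P k => ball (0 : E3) Real.pi).indicator
          (fun A => (∏ i, expWeight (A i)) • F (fluctFree fun i => expPoint (A i))) (S.gk k • A)
        = sigma0 ^ Fintype.card (Free S.P k) *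
          ((Set.univ.pi fun _ : Free S.P k => ball (0 : E3) Real.pi).indicator (fun _ => (1 : ℝ)) (S.gk k • A) *
            (∏ i, expWeight ((S.gk k • A) i) / sigma0) * ρ (fieldAt U₁ (S.gk k) V A)) := fun A => by
    have hFA : F (fluctFree fun i => expPoint ((S.gk k • A) i)) = ρ (fieldAt U₁ (S.gk k) V A) := rfl
    by_cases hA : S.gk k • A ∈ Set.univ.pi fun _ : Free S.P k => ball (0 : E3) Real.pi
    · rw [Set.indicator_of_mem hA, Set.indicator_of_mem hA, smul_eq_mul, prod_expWeight_eq, hFA]; ring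
    · rw [Set.indicator_of_notMem hA, Set.indicator_of_notMem hA]; ring
  simp_rw [hpt]
  rw [integral_const_mul]
  have e1 : Real.exp (Real.log sigma0 * (Fintype.card (Free S.P k) : ℝ)) = sigma0 ^ Fintype.card (Free S.P k) := by
    rw [mul_comm, Real.exp_nat_mul, Real.exp_log sigma0_pos]
  have e2 : Real.exp (3 * Real.log (S.gk k) * (Fintype.card (Free S.P k) : ℝ)) = S.gk k ^ (3 * Fintype.card (Free S.P k)) := by
    rw [show (3 : ℝ) * Real.log (S.gk k) * (Fintype.card (Free S.P k) : ℝ) = ((3 * Fintype.card (Free S.P k) : ℕ) : ℝ) * Real.log (S.gk k) by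
      push_cast; ring, Real.exp_nat_mul, Real.exp_log hg]
  rw [show (Real.log sigma0 + 3 * Real.log (S.gk k)) * (Fintype.card (Free S.P k) : ℝ)
      = Real.log sigma0 * (Fintype.card (Free S.P k) : ℝ) + 3 * Real.log (S.gk k) * (Fintype.card (Free S.P k) : ℝ) by ring,
    Real.exp_add, e1, e2]
  ring

end Summit.QuantumFields.YangMills.Theorems.PinnedStepTrivPins

end
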